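import Mathlib
import Summits.ValiantsHypothesis.ValiantsHypothesis.Theorems.RigidityForcesSymmetryRankRigidMinimalReprLaplaceFiveOnShellEqnsA
import Summits.ValiantsHypothesis.ValiantsHypothesis.Theorems.RigidityForcesSymmetryRankRigidMinimalReprLaplaceFiveOnShellEqnsB
import Summits.ValiantsHypothesis.ValiantsHypothesis.Theorems.RigidityForcesSymmetryRankRigidMinimalReprLaplaceFiveOnShellJunk

/-!
# ValiantsHypothesis / RigidityForcesSymmetry — crux `LaplaceOptimalFive` (stmt-ValiantsHypothesis-24813), line
`shallow_collision`, stub S1 `stub_onShell_five`: CASE A (some depth-one junk) ⇒ weight ≥ 120.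

For an on-shell cylindrical exact term system (`OnShellAll` form, unfolded) with flattening sums
`Y ω (S₀, Q)` (`…OnShellCanonTwo.flat_equation`): if for some word `ω` with `ω 0 = ω 1` one of the 35 depth-one
flattening sums `Y ω ({p}, {0})`, `Y ω ({p,q}, {0,x})` is nonzero, then the Laplace weight is `≥ 120`.
Proof: the 28 load-bearing exactness equations at the words `ω ∘ ρ` (`flat_equation`, side conditions by
`decide`) feed `junk_dichotomy` (LEMMA J); its occupied family becomes weight by `weight_ge_of_fibers`.

Honest framing.  A helper toward S1; nothing here proves `LaplaceOptimalFive` (OPEN), `RankRigidMinimalRepr` or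
`VP ≠ VNP`.  No definitions, no `sorry`; script-generated word lists, Mathlib only.
-/

set_option linter.dupNamespace false

namespace Summit.ValiantsHypothesis.ValiantsHypothesis.Theorems.RigidityForcesSymmetryRankRigidMinimalRepr

namespace LaplaceFiveOnShell

open Finset

variable {N : ℕ} (T : Finset (Fin N)) (S : Fin N → Finset (Fin 5)) (u w : Fin N → (Fin 5 → Fin 5) → ℂ)

/-- **CASE A of S1**: a nonzero depth-one junk sum forces Laplace weight `≥ 120`. [folklore] -/
theorem weight_ge_of_junk
    (ho1 : ∀ t v, ((S t).image v).card < (S t).card → u t v = 0)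
    (ho3 : ∀ t v, (((S t)ᶜ).image v).card < ((S t)ᶜ).card → w t v = 0)
    (hid : ∀ v : Fin 5 → Fin 5, (∑ t ∈ T, u t v * w t v) = if Function.Injective v then 1 else 0)
    (F G : Fin N → Finset (Fin 5) → ℂ) (hF : ∀ t v, u t v = F t ((S t).image v))
    (hG : ∀ t v, w t v = G t (((S t)ᶜ).image v))
    (Y : (Fin 5 → Fin 5) → Finset (Fin 5) × Finset (Fin 5) → ℂ)
    (hY : ∀ (ω' : Fin 5 → Fin 5) (S₀ Q : Finset (Fin 5)), Y ω' (S₀, Q)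
      = (∑ t ∈ T.filter (fun t => S t = S₀),
          F t (Q.image ω') * G t ((insert (0 : Fin 5) (({0, 2, 3, 4} : Finset (Fin 5)) \ Q)).image ω'))
        + ∑ t ∈ T.filter (fun t => S t = S₀ᶜ),
          F t ((insert (0 : Fin 5) (({0, 2, 3, 4} : Finset (Fin 5)) \ Q)).image ω') * G t (Q.image ω'))
    (ω : Fin 5 → Fin 5) (hω : ω 0 = ω 1)
    (hnz : ¬ ((∀ p : Fin 5, Y ω ({p}, {0}) = 0) ∧ Y ω ({0, 1}, {0, 2}) = 0 ∧ Y ω ({0, 1}, {0, 3}) =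
        0 ∧ Y ω ({0, 1}, {0, 4}) = 0 ∧ Y ω ({0, 2}, {0, 2}) = 0 ∧ Y ω ({0, 2}, {0, 3}) = 0 ∧ Y ω
        ({0, 2}, {0, 4}) = 0 ∧ Y ω ({0, 3}, {0, 2}) = 0 ∧ Y ω ({0, 3}, {0, 3}) = 0 ∧ Y ω ({0, 3},
        {0, 4}) = 0 ∧ Y ω ({0, 4}, {0, 2}) = 0 ∧ Y ω ({0, 4}, {0, 3}) = 0 ∧ Y ω ({0, 4}, {0, 4}) = 0
        ∧ Y ω ({1, 2}, {0, 2}) = 0 ∧ Y ω ({1, 2}, {0, 3}) = 0 ∧ Y ω ({1, 2}, {0, 4}) = 0 ∧ Y ω ({1,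
        3}, {0, 2}) = 0 ∧ Y ω ({1, 3}, {0, 3}) = 0 ∧ Y ω ({1, 3}, {0, 4}) = 0 ∧ Y ω ({1, 4}, {0, 2})
        = 0 ∧ Y ω ({1, 4}, {0, 3}) = 0 ∧ Y ω ({1, 4}, {0, 4}) = 0 ∧ Y ω ({2, 3}, {0, 2}) = 0 ∧ Y ω
        ({2, 3}, {0, 3}) = 0 ∧ Y ω ({2, 3}, {0, 4}) = 0 ∧ Y ω ({2, 4}, {0, 2}) = 0 ∧ Y ω ({2, 4},
        {0, 3}) = 0 ∧ Y ω ({2, 4}, {0, 4}) = 0 ∧ Y ω ({3, 4}, {0, 2}) = 0 ∧ Y ω ({3, 4}, {0, 3}) = 0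
        ∧ Y ω ({3, 4}, {0, 4}) = 0)) :
    Nat.factorial 5 ≤ ∑ t ∈ T, (S t).card.factorial * (5 - (S t).card).factorial := by
  classical
  have hOβ : ∀ p : Fin 5, (fun p : Fin 5 => Y ω ({p}, {0})) p ≠ 0 → ∃ t ∈ T, S t = {p} ∨ S t = {p}ᶜ :=
    fun p hp => occupied_of_flat_ne_zero T S F G Y hY ω _ _ hp
  have hOy : ∀ p q x : Fin 5, (fun p q x : Fin 5 => Y ω ({p, q}, {0, x})) p q x ≠ 0 →
      ∃ t ∈ T, S t = {p, q} ∨ S t = {p, q}ᶜ :=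
    fun p q x hp => occupied_of_flat_ne_zero T S F G Y hY ω _ _ hp
  -- the load-bearing exactness equations at the words `ω ∘ ρ` (`…EqnsA/B`)
  have E00 := eqn_00 T S u w ho1 ho3 hid F G hF hG Y hY ω hω
  have E01 := eqn_01 T S u w ho1 ho3 hid F G hF hG Y hY ω hω
  have E02 := eqn_02 T S u w ho1 ho3 hid F G hF hG Y hY ω hω
  have E03 := eqn_03 T S u w ho1 ho3 hid F G hF hG Y hY ω hω
  have E04 := eqn_04 T S u w ho1 ho3 hid F G hF hG Y hY ω hω
  have E06 := eqn_06 T S u w ho1 ho3 hid F G hF hG Y hY ω hω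
  have E07 := eqn_07 T S u w ho1 ho3 hid F G hF hG Y hY ω hω
  have E08 := eqn_08 T S u w ho1 ho3 hid F G hF hG Y hY ω hω
  have E09 := eqn_09 T S u w ho1 ho3 hid F G hF hG Y hY ω hω
  have E10 := eqn_10 T S u w ho1 ho3 hid F G hF hG Y hY ω hω
  have E12 := eqn_12 T S u w ho1 ho3 hid F G hF hG Y hY ω hω
  have E13 := eqn_13 T S u w ho1 ho3 hid F G hF hG Y hY ω hω
  have E15 := eqn_15 T S u w ho1 ho3 hid F G hF hG Y hY ω hω
  have E18 := eqn_18 T S u w ho1 ho3 hid F G hF hG Y hY ω hω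
  have E24 := eqn_24 T S u w ho1 ho3 hid F G hF hG Y hY ω hω
  have E25 := eqn_25 T S u w ho1 ho3 hid F G hF hG Y hY ω hω
  have E26 := eqn_26 T S u w ho1 ho3 hid F G hF hG Y hY ω hω
  have E27 := eqn_27 T S u w ho1 ho3 hid F G hF hG Y hY ω hω
  have E28 := eqn_28 T S u w ho1 ho3 hid F G hF hG Y hY ω hω
  have E30 := eqn_30 T S u w ho1 ho3 hid F G hF hG Y hY ω hω
  have E31 := eqn_31 T S u w ho1 ho3 hid F G hF hG Y hY ω hω
  have E33 := eqn_33 T S u w ho1 ho3 hid F G hF hG Y hY ω hω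
  have E36 := eqn_36 T S u w ho1 ho3 hid F G hF hG Y hY ω hω
  have E42 := eqn_42 T S u w ho1 ho3 hid F G hF hG Y hY ω hω
  have E43 := eqn_43 T S u w ho1 ho3 hid F G hF hG Y hY ω hω
  have E45 := eqn_45 T S u w ho1 ho3 hid F G hF hG Y hY ω hω
  have E48 := eqn_48 T S u w ho1 ho3 hid F G hF hG Y hY ω hω
  have E54 := eqn_54 T S u w ho1 ho3 hid F G hF hG Y hY ω hω
  rcases junk_dichotomy (fun p : Fin 5 => Y ω ({p}, {0})) (fun p q x : Fin 5 => Y ω ({p, q}, {0,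
      x})) (fun S₀ => ∃ t ∈ T, S t = S₀ ∨ S t = S₀ᶜ) hOβ hOy E00 E01 E02 E03 E04 E06 E07 E08 E09 E10
      E12 E13 E15 E18 E24 E25 E26 E27 E28 E30 E31 E33 E36 E42 E43 E45 E48 E54 with hall | ⟨R, hR12,
      hR120, hRocc⟩
  · exact absurd hall hnz
  · refine le_trans hR120 (weight_ge_of_fibers T S R ?_ hRocc)
    intro S₀ h₀ S₁ h₁ heq
    have hc : S₁.card = 5 - S₀.card := by rw [heq, Finset.card_compl, Fintype.card_fin]
    rcases hR12 S₀ h₀ with h | h <;> rcases hR12 S₁ h₁ with h' | h' <;> omega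

end LaplaceFiveOnShell

end Summit.ValiantsHypothesis.ValiantsHypothesis.Theorems.RigidityForcesSymmetryRankRigidMinimalRepr
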